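import Summits.QuantumFields.BalabanUV.Beta.GAN24.LegTowerSlavedDriftRows

/-!
# `BalabanUV.Beta.GAN24.LegTowerMemberRows` — binder row G-an2-4 ∕ (CONV-C), W-slot, the (α-0) parity re-cut, row L11 (Q-L): **THE (Q-L) END AND ITS DRIFT TWIN WITH
# DIRECT CLASS MEMBERSHIP OF THE TOWER MEMBERS** — the OWNER gan24-p1 g35's RULING R-gan24p1-g35-1 (2)(a): the class `P` on which (H1♮) is asked is «jointly
# `Lc`-covariant ∧ ff-charge-free ∧ `LocStencil₂`», and «the leg letters are in it AUTOMATICALLY» — so the socket must take the MEMBERSHIP of the actual members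
# `Δ_n = rdiv ∘ T_n` (resp. `Δ_{n+1} − Δ_n`) as its class hypothesis, NOT the closure of `P` under the step maps (which would need (LAY-leg)) (G-an2-4 formalisation
# swarm, leaf prover `b2b-balaban-gan24-formalise-leaf-03`, gen 67; FILE 8a of the journal INTENT [LEAF03-G67-ONLINE]; re-cuts MY FILE 1 `LegTowerSlavedRows` §2–§3 and
# MY FILE 4b `LegTowerSlavedDriftRows` §2–§3 through the abstract sockets `good_tower_of_kfold_slaved` ∕ `TowerRateSlavedSocket.good_tower_rate_of_kfold_slaved`, whose
# class hypothesis IS direct membership `hxP`)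

NOT IN PRINT; OUR BOOKKEEPING ([folklore] window bookkeeping BY NAME; 0 `def`, 0 cited facts, 0 `def … : Prop`, 0 sorry).  HONEST FRAMING (cell contract,
verbatim): «discharging `BetaPertH` makes Bałaban's UV stability UNCONDITIONAL — a real constructive-QFT result; it is NOT the continuum limit and NOT the Clay
problem.»  HONEST DEPENDENCY (verbatim): «continuum YM on T⁴ ⇐ BetaPertH ∧ nine spine estimates (0/9 proved); BetaPertH ⇐ (D1) ∧ (D4) ∧ CAP+tail; G-an2-4
gates asym, D1 and NE2/3/4.»

WHAT (g60's objects; `Δ n := fun s ↦ rdiv (T n s)`; `Good` subadditive ∕ monotone, `GoodL` arbitrary; `P` ANY class).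
* §1 **`good_rdiv_tower_of_window_slaved_mem`** — MY FILE 1's `good_rdiv_tower_of_window_slaved` with the four class rows `hP0 hPF hPadd hPA` REPLACED by
  `hxP : ∀ n, P (Δ n)`; **`good_rdiv_towerDiff_of_window_slaved_mem`** — MY FILE 4b's `good_rdiv_towerDiff_of_window_slaved` with its class rows replaced by
  `hDP : ∀ n, P (Δ_{n+1} − Δ_n)`.  (H1♮) is asked ONLY on bounded `W ∈ P`; the window step applies it to the members, whose membership is `hxP` ∕ `hDP`.
* §2 THE DRESSED COMB TOWER WITH A FIXED ROOT, `LocStencil₂` CURRENCY, FROM THE AFFINE RECURSION: **`locStencil₂_rdiv_tower_of_window_slaved_comb_mem`**,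
  **`locStencil₂_rdiv_towerDiff_of_window_slaved_comb_mem`** (member boundedness by leaf-01's `lin4_bdd`, the closed law by g60's `rdiv_lin4_affine` with g58's comb Ward
  laws — as in MY FILE 1's `_of_rec ∕ _comb`).
DISPLAYED, NOT discharged: (H1♮) (on `P`), (H2)∕(H2d), (H0)∕(H0d), (H3)∕(H3d), and the memberships `hxP ∕ hDP` (FILE 8b discharges them for the ruled class at the parity
member).  Asserts NO bound on any chain; discharges NOTHING of (Q-L) ∕ (C) ∕ «T2Shape» ∕ «T2Drift» ∕ (hW, hWall); NEVER «G-an2-4 closed» as (CONV-C); NOT D1, NOT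
`BetaPertH`, NOT continuum, NOT Clay; not in print.  Unit `b2b-balaban-gan24-formalise-leaf-03` (gen 67), 2026-08-23.
-/

noncomputable section
open Finset
open scoped BigOperators
open Literature.MathematicalPhysics.QuantumFieldTheory
open Literature.MathematicalPhysics.QuantumFieldTheory.Balaban1983to89
open Literature.MathematicalPhysics.QuantumFieldTheory.Balaban1983to89.Beta
open ExpKernelCalculus (MKer Site Decays)
open OneStepResolventKernel (Fib)
open OneStepKernelFamily (KInvStep)
open AffineAveraging (box toSite)
open BalabanCompositeJets (LocStencil₂)
open Summit.QuantumFields.BalabanUV.Beta.GAN24.T2RecursionAffine (lin4)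
open Summit.QuantumFields.BalabanUV.Beta.HessKerDressedUnits (unitK decays_unitK)
open Summit.QuantumFields.BalabanUV.Beta.GAN24.CombesThomas (sfStep smStep)
open Summit.QuantumFields.BalabanUV.Beta.AxialDressingRooted (coDressKBmAt one_le_of_neZero decays_coDressKBmAt_KInvStep)
open Summit.QuantumFields.BalabanUV.Beta.GAN24.Lin4SlotDivergence (hH_unitK_comb)
open Summit.QuantumFields.BalabanUV.Beta.GAN24.Lin4LegDivergence (hM_unitK_comb)
open Summit.QuantumFields.BalabanUV.Beta.GAN24.Lin4LegTower (rdiv bsum legStep rdiv_lin4_affine)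
open Summit.QuantumFields.BalabanUV.Beta.GAN24.Lin4LegTowerUnroll (legStepB bsumPow legChain transport_legStepB_eq bddTab_rdiv bddTab_legStepB)
open Summit.QuantumFields.BalabanUV.Beta.GAN24.AffineUnroll (transport)
open Summit.QuantumFields.BalabanUV.Beta.GAN24.T2UnitSplitLevels (bdd₄_add bdd₄_sub)
open Summit.QuantumFields.BalabanUV.Beta.GAN24.LegTowerRows (rdiv_tower_window)
open Summit.QuantumFields.BalabanUV.Beta.GAN24.WSlotT2OfPieces (locStencil₂_add locStencil₂_mono)
open Summit.QuantumFields.BalabanUV.Beta.GAN24.LegTowerSlavedRows (good_tower_of_kfold_slaved)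
open Summit.QuantumFields.BalabanUV.Beta.GAN24.TowerRateSlavedSocket (good_tower_rate_of_kfold_slaved)
open Summit.QuantumFields.BalabanUV.Beta.GAN24.LegTowerSlavedDriftRows (rdiv_towerDiff_window)

namespace Summit.QuantumFields.BalabanUV.Beta.GAN24.LegTowerMemberRows

/-! ## §1 The leg tower and its difference tower: direct membership -/

section Leg

variable {d : ℕ} {N : ℕ} {kc : ℕ → ℝ} {K : ℕ → MKer (d + 1) (Fib d)}
  {T F : ℕ → (Fin (d + 1) → (Fin (d + 1) → ℤ) → Fin (d + 1) → (Fin (d + 1) → ℤ) → MKer (d + 1) (Fib d))}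

/-- NOT IN PRINT; OUR BOOKKEEPING.  **THE (Q-L) END WITH THE SLAVED TERM, DIRECT MEMBERSHIP** (RULING R-gan24p1-g35-1 (2)(a)): MY FILE 1's
`good_rdiv_tower_of_window_slaved` with the class-closure rows replaced by `hxP : ∀ n, P (Δ n)` — (H1♮) is asked on bounded `W ∈ P` only, and is applied to the members. -/
theorem good_rdiv_tower_of_window_slaved_mem (hK : ∀ m, ∃ δ C : ℝ, 0 < δ ∧ Decays (K m) C δ)
    (hT : ∀ m, ∃ B : ℝ, ∀ κ u κ' u' x z a b, |T m κ u κ' u' x z a b| ≤ B) (hF : ∀ m, ∃ B : ℝ, ∀ κ u κ' u' x z a b, |F m κ u κ' u' x z a b| ≤ B)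
    (hstep : ∀ m κ u κ' u', rdiv (T (m + 1) κ u κ' u')
      = legStep (kc m) (K m) (K m) N (fun κ u κ' u' => bsum N (rdiv (T m κ u κ' u'))) κ u κ' u' + rdiv (F m κ u κ' u'))
    (P : (Fin (d + 1) → (Fin (d + 1) → ℤ) → Fin (d + 1) → (Fin (d + 1) → ℤ) → MKer (d + 1) (Fib d)) → Prop) (hxP : ∀ n, P (fun κ u κ' u' => rdiv (T n κ u κ' u')))
    {Good GoodL : (Fin (d + 1) → (Fin (d + 1) → ℤ) → Fin (d + 1) → (Fin (d + 1) → ℤ) → MKer (d + 1) (Fib d)) → ℝ → Prop}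
    (hGadd : ∀ X Y c c', Good X c → Good Y c' → Good (X + Y) (c + c')) (hGmono : ∀ X c c', c ≤ c' → Good X c → Good X c')
    {k₀ : ℕ} (hk : 0 < k₀) {θ Cg s M σ : ℝ} (hθ0 : 0 ≤ θ) (hθ1 : θ < 1) (hCg : 0 ≤ Cg) (hs : 0 ≤ s) (hM : 0 ≤ M) (hσ : 0 ≤ σ)
    (H1 : ∀ n (W : (Fin (d + 1) → (Fin (d + 1) → ℤ) → Fin (d + 1) → (Fin (d + 1) → ℤ) → MKer (d + 1) (Fib d))) (c g : ℝ), P W →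
      (∃ B : ℝ, ∀ κ u κ' u' x z a b, |W κ u κ' u' x z a b| ≤ B) → Good W c → GoodL W g →
        Good (legChain kc K N n k₀ (fun κ u κ' u' => bsumPow N k₀ (W κ u κ' u'))) (θ * c + Cg * g))
    (H2 : ∀ n, Good (∑ m ∈ Finset.range k₀, transport (legStepB kc K N) (n + m + 1) (k₀ - 1 - m) (fun κ u κ' u' => rdiv (F (n + m) κ u κ' u'))) s)
    (H0 : ∀ i, i < k₀ → Good (fun κ u κ' u' => rdiv (T i κ u κ' u')) M)
    (H3 : ∀ n, GoodL (fun κ u κ' u' => rdiv (T n κ u κ' u')) σ) (n : ℕ) :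
    Good (fun κ u κ' u' => rdiv (T n κ u κ' u')) (M + (Cg * σ + s) * (1 - θ)⁻¹) := by
  refine good_tower_of_kfold_slaved (Good := Good) (GoodL := GoodL)
    (P := fun W => P W ∧ ∃ B : ℝ, ∀ κ u κ' u' x z a b, |W κ u κ' u' x z a b| ≤ B)
    (x := fun i => fun κ u κ' u' => rdiv (T i κ u κ' u')) (Φ := fun m W => transport (legStepB kc K N) m k₀ W)
    (S := fun m => ∑ j ∈ Finset.range k₀, transport (legStepB kc K N) (m + j + 1) (k₀ - 1 - j) (fun κ u κ' u' => rdiv (F (m + j) κ u κ' u')))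
    hGadd hGmono hk (fun m => rdiv_tower_window hK hT hF hstep m k₀) (fun m => ⟨hxP m, bddTab_rdiv (hT m)⟩) hθ0 hθ1 hCg hs hM hσ
    (fun m W c g hW hc hg => ?_) H2 H0 H3 n
  show Good (transport (legStepB kc K N) m k₀ W) (θ * c + Cg * g)
  rw [transport_legStepB_eq hK m k₀ hW.2]
  exact H1 m W c g hW.1 hW.2 hc hg

/-- NOT IN PRINT; OUR BOOKKEEPING.  **THE DRIFT TWIN, DIRECT MEMBERSHIP**: MY FILE 4b's `good_rdiv_towerDiff_of_window_slaved` with the class-closure rows replaced by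
`hDP : ∀ n, P (Δ_{n+1} − Δ_n)`. -/
theorem good_rdiv_towerDiff_of_window_slaved_mem (hK : ∀ m, ∃ δ C : ℝ, 0 < δ ∧ Decays (K m) C δ)
    (hT : ∀ m, ∃ B : ℝ, ∀ κ u κ' u' x z a b, |T m κ u κ' u' x z a b| ≤ B) (hF : ∀ m, ∃ B : ℝ, ∀ κ u κ' u' x z a b, |F m κ u κ' u' x z a b| ≤ B)
    (hstep : ∀ m κ u κ' u', rdiv (T (m + 1) κ u κ' u')
      = legStep (kc m) (K m) (K m) N (fun κ u κ' u' => bsum N (rdiv (T m κ u κ' u'))) κ u κ' u' + rdiv (F m κ u κ' u'))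
    (P : (Fin (d + 1) → (Fin (d + 1) → ℤ) → Fin (d + 1) → (Fin (d + 1) → ℤ) → MKer (d + 1) (Fib d)) → Prop)
    (hDP : ∀ n, P ((fun κ u κ' u' => rdiv (T (n + 1) κ u κ' u')) - fun κ u κ' u' => rdiv (T n κ u κ' u')))
    {Good GoodL : (Fin (d + 1) → (Fin (d + 1) → ℤ) → Fin (d + 1) → (Fin (d + 1) → ℤ) → MKer (d + 1) (Fib d)) → ℝ → Prop}
    (hGadd : ∀ X Y c c', Good X c → Good Y c' → Good (X + Y) (c + c')) (hGmono : ∀ X c c', c ≤ c' → Good X c → Good X c')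
    {k₀ : ℕ} (hk : 0 < k₀) {θ Cg s M σ μ : ℝ} (hθ0 : 0 ≤ θ) (hθ1 : θ < 1) (hCg : 0 ≤ Cg) (hs : 0 ≤ s) (hM : 0 ≤ M) (hσ : 0 ≤ σ)
    (hμ0 : 0 ≤ μ) (hμ1 : μ < 1)
    (H1 : ∀ n (W : (Fin (d + 1) → (Fin (d + 1) → ℤ) → Fin (d + 1) → (Fin (d + 1) → ℤ) → MKer (d + 1) (Fib d))) (c g : ℝ), P W →
      (∃ B : ℝ, ∀ κ u κ' u' x z a b, |W κ u κ' u' x z a b| ≤ B) → Good W c → GoodL W g →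
        Good (legChain kc K N n k₀ (fun κ u κ' u' => bsumPow N k₀ (W κ u κ' u'))) (θ * c + Cg * g))
    (H2 : ∀ n, Good (∑ m ∈ Finset.range k₀, transport (legStepB kc K N) (n + m + 2) (k₀ - 1 - m)
      ((legStepB kc K N (n + m + 1) (fun κ u κ' u' => rdiv (T (n + m) κ u κ' u'))
          - legStepB kc K N (n + m) (fun κ u κ' u' => rdiv (T (n + m) κ u κ' u')))
        + ((fun κ u κ' u' => rdiv (F (n + m + 1) κ u κ' u')) - fun κ u κ' u' => rdiv (F (n + m) κ u κ' u')))) (s * μ ^ n))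
    (H0 : ∀ i, i < k₀ → Good ((fun κ u κ' u' => rdiv (T (i + 1) κ u κ' u')) - fun κ u κ' u' => rdiv (T i κ u κ' u')) M)
    (H3 : ∀ n, GoodL ((fun κ u κ' u' => rdiv (T (n + 1) κ u κ' u')) - fun κ u κ' u' => rdiv (T n κ u κ' u')) (σ * μ ^ n)) :
    ∃ c ϑ : ℝ, 0 ≤ c ∧ 0 < ϑ ∧ ϑ < 1 ∧
      ∀ n, Good ((fun κ u κ' u' => rdiv (T (n + 1) κ u κ' u')) - fun κ u κ' u' => rdiv (T n κ u κ' u')) (c * ϑ ^ n) := by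
  refine good_tower_rate_of_kfold_slaved (Good := Good) (GoodL := GoodL)
    (P := fun W => P W ∧ ∃ B : ℝ, ∀ κ u κ' u' x z a b, |W κ u κ' u' x z a b| ≤ B)
    (x := fun n => (fun κ u κ' u' => rdiv (T (n + 1) κ u κ' u')) - fun κ u κ' u' => rdiv (T n κ u κ' u'))
    (Φ := fun m W => transport (legStepB kc K N) (m + 1) k₀ W)
    (S := fun n => ∑ m ∈ Finset.range k₀, transport (legStepB kc K N) (n + m + 2) (k₀ - 1 - m)
      ((legStepB kc K N (n + m + 1) (fun κ u κ' u' => rdiv (T (n + m) κ u κ' u'))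
          - legStepB kc K N (n + m) (fun κ u κ' u' => rdiv (T (n + m) κ u κ' u')))
        + ((fun κ u κ' u' => rdiv (F (n + m + 1) κ u κ' u')) - fun κ u κ' u' => rdiv (F (n + m) κ u κ' u'))))
    hGadd hGmono hk (fun m => rdiv_towerDiff_window hK hT hF hstep m k₀)
    (fun n => ⟨hDP n, bdd₄_sub (bddTab_rdiv (hT (n + 1))) (bddTab_rdiv (hT n))⟩) hθ0 hθ1 hCg hs hM hσ hμ0 hμ1
    (fun m W c g hW hc hg => ?_) H2 H0 H3
  show Good (transport (legStepB kc K N) (m + 1) k₀ W) (θ * c + Cg * g)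
  rw [transport_legStepB_eq hK (m + 1) k₀ hW.2]
  exact H1 (m + 1) W c g hW.1 hW.2 hc hg

end Leg

/-! ## §2 The dressed comb tower with a fixed root, `LocStencil₂` currency, from the affine recursion -/

section Comb

variable {d : ℕ} {Lc : ℕ} [NeZero Lc] {r : Fin (d + 1) → ℕ}

/-- NOT IN PRINT; OUR BOOKKEEPING.  **THE (Q-L) END FOR THE DRESSED COMB TOWER (fixed root), `LocStencil₂` CURRENCY, DIRECT MEMBERSHIP** (`T (m+1) = lin4 (c m) K♮ᴱ_m Lc (T m)
+ F m`, `T 0` and the sources bounded; every member bounded by leaf-01's `lin4_bdd`, the closed one-step law by g60's `rdiv_lin4_affine` with g58's comb Ward laws):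
`hxP` ∧ (H1♮ on `P`)_δ ∧ (H2)_δ ∧ (H0)_δ ∧ (H3) ⟹ `∀ n, LocStencil₂ (rdiv ∘ T n) (M + (Cg·σ + s)·(1 − θ)⁻¹) δ`. -/
theorem locStencil₂_rdiv_tower_of_window_slaved_comb_mem (hr : r ∈ box (d + 1) Lc) (c : ℕ → ℝ)
    {T F : ℕ → (Fin (d + 1) → (Fin (d + 1) → ℤ) → Fin (d + 1) → (Fin (d + 1) → ℤ) → MKer (d + 1) (Fib d))}
    (hT0 : ∃ B : ℝ, ∀ κ u κ' u' x z a b, |T 0 κ u κ' u' x z a b| ≤ B) (hF : ∀ m, ∃ B : ℝ, ∀ κ u κ' u' x z a b, |F m κ u κ' u' x z a b| ≤ B)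
    (hrec : ∀ m, T (m + 1) = lin4 (c m) (unitK (sfStep Lc m) (smStep d Lc m) (coDressKBmAt (toSite r) Lc (KInvStep (d := d) Lc m))) Lc (T m) + F m)
    (P : (Fin (d + 1) → (Fin (d + 1) → ℤ) → Fin (d + 1) → (Fin (d + 1) → ℤ) → MKer (d + 1) (Fib d)) → Prop) (hxP : ∀ n, P (fun κ u κ' u' => rdiv (T n κ u κ' u')))
    {GoodL : (Fin (d + 1) → (Fin (d + 1) → ℤ) → Fin (d + 1) → (Fin (d + 1) → ℤ) → MKer (d + 1) (Fib d)) → ℝ → Prop} (δ : ℝ)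
    {k₀ : ℕ} (hk : 0 < k₀) {θ Cg s M σ : ℝ} (hθ0 : 0 ≤ θ) (hθ1 : θ < 1) (hCg : 0 ≤ Cg) (hs : 0 ≤ s) (hM : 0 ≤ M) (hσ : 0 ≤ σ)
    (H1 : ∀ n (W : (Fin (d + 1) → (Fin (d + 1) → ℤ) → Fin (d + 1) → (Fin (d + 1) → ℤ) → MKer (d + 1) (Fib d))) (C g : ℝ), P W →
      (∃ B : ℝ, ∀ κ u κ' u' x z a b, |W κ u κ' u' x z a b| ≤ B) → LocStencil₂ W C δ → GoodL W g →
        LocStencil₂ (legChain (fun m => -(c m * ((Lc : ℝ) ^ (d + 1))⁻¹))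
          (fun m => unitK (sfStep Lc m) (smStep d Lc m) (coDressKBmAt (toSite r) Lc (KInvStep (d := d) Lc m))) Lc n k₀
          (fun κ u κ' u' => bsumPow Lc k₀ (W κ u κ' u'))) (θ * C + Cg * g) δ)
    (H2 : ∀ n, LocStencil₂ (∑ m ∈ Finset.range k₀, transport (legStepB (fun m => -(c m * ((Lc : ℝ) ^ (d + 1))⁻¹))
      (fun m => unitK (sfStep Lc m) (smStep d Lc m) (coDressKBmAt (toSite r) Lc (KInvStep (d := d) Lc m))) Lc) (n + m + 1) (k₀ - 1 - m)
      (fun κ u κ' u' => rdiv (F (n + m) κ u κ' u'))) s δ)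
    (H0 : ∀ i, i < k₀ → LocStencil₂ (fun κ u κ' u' => rdiv (T i κ u κ' u')) M δ)
    (H3 : ∀ n, GoodL (fun κ u κ' u' => rdiv (T n κ u κ' u')) σ) (n : ℕ) :
    LocStencil₂ (fun κ u κ' u' => rdiv (T n κ u κ' u')) (M + (Cg * σ + s) * (1 - θ)⁻¹) δ := by
  have hK : ∀ m, ∃ δ C : ℝ, 0 < δ ∧ Decays (unitK (sfStep Lc m) (smStep d Lc m) (coDressKBmAt (toSite r) Lc (KInvStep (d := d) Lc m))) C δ := by
    intro m
    obtain ⟨δK, CK, hδK, -, hG⟩ := decays_coDressKBmAt_KInvStep (d := d) hr m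
    exact ⟨δK, _, hδK, decays_unitK hG⟩
  have hTb : ∀ m, ∃ B : ℝ, ∀ κ u κ' u' x z a b, |T m κ u κ' u' x z a b| ≤ B := by
    intro m
    induction m with
    | zero => exact hT0
    | succ m ih =>
      obtain ⟨δ', C', hδ', hKm⟩ := hK m
      rw [hrec m]
      exact bdd₄_add (Lin4Additive.lin4_bdd hKm hδ' (c m) Lc ih) (hF m)
  have hstep : ∀ m κ u κ' u', rdiv (T (m + 1) κ u κ' u')
      = legStep (-(c m * ((Lc : ℝ) ^ (d + 1))⁻¹)) (unitK (sfStep Lc m) (smStep d Lc m) (coDressKBmAt (toSite r) Lc (KInvStep (d := d) Lc m)))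
          (unitK (sfStep Lc m) (smStep d Lc m) (coDressKBmAt (toSite r) Lc (KInvStep (d := d) Lc m))) Lc
          (fun κ u κ' u' => bsum Lc (rdiv (T m κ u κ' u'))) κ u κ' u' + rdiv (F m κ u κ' u') := by
    intro m κ u κ' u'
    obtain ⟨δ', C', hδ', hKm⟩ := hK m
    obtain ⟨B, hB⟩ := hTb m
    rw [hrec m]
    exact rdiv_lin4_affine hKm hδ' (one_le_of_neZero Lc) (c m) hB (hH_unitK_comb hr m) (hM_unitK_comb m) (F m) κ u κ' u'
  exact good_rdiv_tower_of_window_slaved_mem (N := Lc) (kc := (fun m => -(c m * ((Lc : ℝ) ^ (d + 1))⁻¹)))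
    (K := (fun m => unitK (sfStep Lc m) (smStep d Lc m) (coDressKBmAt (toSite r) Lc (KInvStep (d := d) Lc m)))) hK hTb hF hstep P hxP
    (Good := fun X C => LocStencil₂ X C δ) (GoodL := GoodL)
    (fun _ _ _ _ hX hY => locStencil₂_add hX hY) (fun _ _ _ hCC hX => locStencil₂_mono hX hCC)
    hk hθ0 hθ1 hCg hs hM hσ H1 H2 H0 H3 n

/-- NOT IN PRINT; OUR BOOKKEEPING.  **THE DRIFT TWIN FOR THE DRESSED COMB TOWER (fixed root), `LocStencil₂` CURRENCY, DIRECT MEMBERSHIP**: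
`hDP` ∧ (H1♮ on `P`)_δ ∧ (H2d)_δ ∧ (H0d)_δ ∧ (H3d) ⟹ `∃ c ϑ, 0 ≤ c ∧ 0 < ϑ < 1 ∧ ∀ n, LocStencil₂ (rdiv ∘ T (n+1) − rdiv ∘ T n) (c·ϑ^n) δ`. -/
theorem locStencil₂_rdiv_towerDiff_of_window_slaved_comb_mem (hr : r ∈ box (d + 1) Lc) (c : ℕ → ℝ)
    {T F : ℕ → (Fin (d + 1) → (Fin (d + 1) → ℤ) → Fin (d + 1) → (Fin (d + 1) → ℤ) → MKer (d + 1) (Fib d))}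
    (hT0 : ∃ B : ℝ, ∀ κ u κ' u' x z a b, |T 0 κ u κ' u' x z a b| ≤ B) (hF : ∀ m, ∃ B : ℝ, ∀ κ u κ' u' x z a b, |F m κ u κ' u' x z a b| ≤ B)
    (hrec : ∀ m, T (m + 1) = lin4 (c m) (unitK (sfStep Lc m) (smStep d Lc m) (coDressKBmAt (toSite r) Lc (KInvStep (d := d) Lc m))) Lc (T m) + F m)
    (P : (Fin (d + 1) → (Fin (d + 1) → ℤ) → Fin (d + 1) → (Fin (d + 1) → ℤ) → MKer (d + 1) (Fib d)) → Prop)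
    (hDP : ∀ n, P ((fun κ u κ' u' => rdiv (T (n + 1) κ u κ' u')) - fun κ u κ' u' => rdiv (T n κ u κ' u')))
    {GoodL : (Fin (d + 1) → (Fin (d + 1) → ℤ) → Fin (d + 1) → (Fin (d + 1) → ℤ) → MKer (d + 1) (Fib d)) → ℝ → Prop} (δ : ℝ)
    {k₀ : ℕ} (hk : 0 < k₀) {θ Cg s M σ μ : ℝ} (hθ0 : 0 ≤ θ) (hθ1 : θ < 1) (hCg : 0 ≤ Cg) (hs : 0 ≤ s) (hM : 0 ≤ M) (hσ : 0 ≤ σ)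
    (hμ0 : 0 ≤ μ) (hμ1 : μ < 1)
    (H1 : ∀ n (W : (Fin (d + 1) → (Fin (d + 1) → ℤ) → Fin (d + 1) → (Fin (d + 1) → ℤ) → MKer (d + 1) (Fib d))) (C g : ℝ), P W →
      (∃ B : ℝ, ∀ κ u κ' u' x z a b, |W κ u κ' u' x z a b| ≤ B) → LocStencil₂ W C δ → GoodL W g →
        LocStencil₂ (legChain (fun m => -(c m * ((Lc : ℝ) ^ (d + 1))⁻¹))
          (fun m => unitK (sfStep Lc m) (smStep d Lc m) (coDressKBmAt (toSite r) Lc (KInvStep (d := d) Lc m))) Lc n k₀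
          (fun κ u κ' u' => bsumPow Lc k₀ (W κ u κ' u'))) (θ * C + Cg * g) δ)
    (H2 : ∀ n, LocStencil₂ (∑ m ∈ Finset.range k₀, transport (legStepB (fun m => -(c m * ((Lc : ℝ) ^ (d + 1))⁻¹))
      (fun m => unitK (sfStep Lc m) (smStep d Lc m) (coDressKBmAt (toSite r) Lc (KInvStep (d := d) Lc m))) Lc) (n + m + 2) (k₀ - 1 - m)
      ((legStepB (fun m => -(c m * ((Lc : ℝ) ^ (d + 1))⁻¹))
          (fun m => unitK (sfStep Lc m) (smStep d Lc m) (coDressKBmAt (toSite r) Lc (KInvStep (d := d) Lc m))) Lc (n + m + 1) (fun κ u κ' u' => rdiv (T (n + m) κ u κ' u'))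
        - legStepB (fun m => -(c m * ((Lc : ℝ) ^ (d + 1))⁻¹))
          (fun m => unitK (sfStep Lc m) (smStep d Lc m) (coDressKBmAt (toSite r) Lc (KInvStep (d := d) Lc m))) Lc (n + m) (fun κ u κ' u' => rdiv (T (n + m) κ u κ' u')))
        + ((fun κ u κ' u' => rdiv (F (n + m + 1) κ u κ' u')) - fun κ u κ' u' => rdiv (F (n + m) κ u κ' u')))) (s * μ ^ n) δ)
    (H0 : ∀ i, i < k₀ → LocStencil₂ ((fun κ u κ' u' => rdiv (T (i + 1) κ u κ' u')) - fun κ u κ' u' => rdiv (T i κ u κ' u')) M δ)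
    (H3 : ∀ n, GoodL ((fun κ u κ' u' => rdiv (T (n + 1) κ u κ' u')) - fun κ u κ' u' => rdiv (T n κ u κ' u')) (σ * μ ^ n)) :
    ∃ c' ϑ : ℝ, 0 ≤ c' ∧ 0 < ϑ ∧ ϑ < 1 ∧
      ∀ n, LocStencil₂ ((fun κ u κ' u' => rdiv (T (n + 1) κ u κ' u')) - fun κ u κ' u' => rdiv (T n κ u κ' u')) (c' * ϑ ^ n) δ := by
  have hK : ∀ m, ∃ δ C : ℝ, 0 < δ ∧ Decays (unitK (sfStep Lc m) (smStep d Lc m) (coDressKBmAt (toSite r) Lc (KInvStep (d := d) Lc m))) C δ := by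
    intro m
    obtain ⟨δK, CK, hδK, -, hG⟩ := decays_coDressKBmAt_KInvStep (d := d) hr m
    exact ⟨δK, _, hδK, decays_unitK hG⟩
  have hTb : ∀ m, ∃ B : ℝ, ∀ κ u κ' u' x z a b, |T m κ u κ' u' x z a b| ≤ B := by
    intro m
    induction m with
    | zero => exact hT0
    | succ m ih =>
      obtain ⟨δ', C', hδ', hKm⟩ := hK m
      rw [hrec m]
      exact bdd₄_add (Lin4Additive.lin4_bdd hKm hδ' (c m) Lc ih) (hF m)
  have hstep : ∀ m κ u κ' u', rdiv (T (m + 1) κ u κ' u')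
      = legStep (-(c m * ((Lc : ℝ) ^ (d + 1))⁻¹)) (unitK (sfStep Lc m) (smStep d Lc m) (coDressKBmAt (toSite r) Lc (KInvStep (d := d) Lc m)))
          (unitK (sfStep Lc m) (smStep d Lc m) (coDressKBmAt (toSite r) Lc (KInvStep (d := d) Lc m))) Lc
          (fun κ u κ' u' => bsum Lc (rdiv (T m κ u κ' u'))) κ u κ' u' + rdiv (F m κ u κ' u') := by
    intro m κ u κ' u'
    obtain ⟨δ', C', hδ', hKm⟩ := hK m
    obtain ⟨B, hB⟩ := hTb m
    rw [hrec m]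
    exact rdiv_lin4_affine hKm hδ' (one_le_of_neZero Lc) (c m) hB (hH_unitK_comb hr m) (hM_unitK_comb m) (F m) κ u κ' u'
  exact good_rdiv_towerDiff_of_window_slaved_mem (N := Lc) (kc := (fun m => -(c m * ((Lc : ℝ) ^ (d + 1))⁻¹)))
    (K := (fun m => unitK (sfStep Lc m) (smStep d Lc m) (coDressKBmAt (toSite r) Lc (KInvStep (d := d) Lc m)))) hK hTb hF hstep P hDP
    (Good := fun X C => LocStencil₂ X C δ) (GoodL := GoodL)
    (fun _ _ _ _ hX hY => locStencil₂_add hX hY) (fun _ _ _ hCC hX => locStencil₂_mono hX hCC)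
    hk hθ0 hθ1 hCg hs hM hσ hμ0 hμ1 H1 H2 H0 H3

end Comb

end Summit.QuantumFields.BalabanUV.Beta.GAN24.LegTowerMemberRows
end
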